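import Summits.QuantumFields.YangMills.Theorems.PoincareLipschitzOrbitMinimiserScalar
import HarnessLib

/-!
# Crux stmt-QuantumFields-19936 `UnitScaleTilt.HistoryTailL`, K2 at depth (route crux `PoincareLipschitz.BlockLipschitzL`, stmt-QuantumFields-23533):
# THE KIRCHHOFF FORM OF ONE-SITE OPTIMALITY — at a box-ℓ²-orbit minimiser the bond current `J_b = W_b − W_b⁻¹` is covariantly conserved

✓`PoincareLipschitzOrbitMinScalar.siteSum_eq_smul_one_of_orbitMin` (this seat, p682271): at a pair `(U, U')` of level-zero `SU(2)` fields with `U'` a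
box-`ℓ²`-closest point of its gauge orbit to `U`, every site matrix `M_x = Σ_{b∈box, b₋=x} U'_bU_b⁻¹ + Σ_{b∈box, b₊=x} U'_b⁻¹U_b` is a real scalar.
A real scalar is Hermitian; reading `M_x = M_xᴴ` with `Vᴴ = V⁻¹` on `SU(2)` gives the statement a linear∕elliptic step consumes, with NO trace and NO
test matrix (`kirchhoff_of_orbitMin`):

  `Σ_{b∈box, b₋=x} (W_b − W_b⁻¹) = Σ_{b∈box, b₊=x} U_b⁻¹ (W_b − W_b⁻¹) U_b`,  `W_b := U'_b U_b⁻¹`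

(written out: `U'_bU_b⁻¹ − U_bU'_b⁻¹` on outgoing bonds, `U_b⁻¹U'_b − U'_b⁻¹U_b` on incoming ones).  `J_b := W_b − W_b⁻¹ = 2·Im W_b ∈ 𝔰𝔲(2)` is the
quaternionic-imaginary part of the perturbation (`= 2 sin|Y_b|·Ŷ_b` for `W_b = exp Y_b`): the 𝔰𝔲(2)-valued bond current of the perturbation is
COVARIANTLY CONSERVED at every site — the exact, non-linear form of the discrete `U`-Coulomb gauge condition `D_U^* Y = 0`.

WHAT THIS IS NOT: nothing here proves the restricted row of ✓`avgStabilityModGauge_of_orbitMinimising_of_small`, `stub_iteratedLipschitz`, the crux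
`BlockLipschitzL`, the crux `HistoryTailL`, rung R3 (YM₃ on T³ — not d = 4, not infinite volume, not a mass gap, not the Clay problem) or a summit
statement.  Width seat ym-ust-19936-w5 g10 (cell ym3-torus), `--supports stmt-QuantumFields-19936`.
-/

noncomputable section

open scoped BigOperators Matrix.Norms.L2Operator Matrix

namespace Summit.QuantumFields.YangMills.Theorems.PoincareLipschitzOrbitMinKirchhoff

open Literature.MathematicalPhysics.QuantumFieldTheory.Balaban1983to89
open Summit.QuantumFields.YangMills.Theorems.PoincareLipschitzOrbitMinScalar (siteSum_eq_smul_one_of_orbitMin)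

variable {P : Params}

/-- On `SU(2)` (indeed on any special unitary group) the underlying matrix of the inverse is the conjugate transpose. [folklore] -/
theorem coe_inv_eq_conjTranspose (V : Matrix.specialUnitaryGroup (Fin 2) ℂ) :
    (((V⁻¹ : Matrix.specialUnitaryGroup (Fin 2) ℂ)) : Matrix (Fin 2) (Fin 2) ℂ) = ((V : Matrix (Fin 2) (Fin 2) ℂ))ᴴ := rfl

/-- ★★ **KIRCHHOFF'S LAW FOR THE PERTURBATION CURRENT AT A BOX-ℓ²-ORBIT MINIMISER.**  If `U'` is a box-`ℓ²`-closest point of its level-zero gauge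
orbit to `U` (`∀ k, Σ_box dist1(U_b U'_b⁻¹)² ≤ Σ_box dist1(U_b((U'^k)_b)⁻¹)²`), then at every site `x`
`Σ_{b∈box, b₋=x} (U'_bU_b⁻¹ − U_bU'_b⁻¹) = Σ_{b∈box, b₊=x} (U_b⁻¹U'_b − U'_b⁻¹U_b)`, i.e. `Σ_out J_b = Σ_in U_b⁻¹J_bU_b` for the current
`J_b = W_b − W_b⁻¹`, `W_b = U'_bU_b⁻¹` (`M_x = M_xᴴ` from ✓`siteSum_eq_smul_one_of_orbitMin`, `Vᴴ = V⁻¹`). [cite: Balaban1985Averaging, (156)–(163) p.42 (the regime this opens)] -/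
theorem kirchhoff_of_orbitMin (box : PBond P 0 → Prop) [DecidablePred box]
    (U U' : GaugeField P 0 (Matrix.specialUnitaryGroup (Fin 2) ℂ))
    (hmin : ∀ k : GaugeTransf P 0 (Matrix.specialUnitaryGroup (Fin 2) ℂ),
      (∑ b : PBond P 0, if box b then dist1 (U b * (U' b)⁻¹) ^ 2 else 0) ≤
        ∑ b : PBond P 0, if box b then dist1 (U b * (GaugeField.gaugeAct k U' b)⁻¹) ^ 2 else 0)
    (x : Site P 0) :
    (∑ b : PBond P 0, if box b ∧ b.src = x then
        ((((U' b : Matrix.specialUnitaryGroup (Fin 2) ℂ) : Matrix (Fin 2) (Fin 2) ℂ) * (((U b)⁻¹ : Matrix.specialUnitaryGroup (Fin 2) ℂ) : Matrix (Fin 2) (Fin 2) ℂ)) -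
          (((U b : Matrix.specialUnitaryGroup (Fin 2) ℂ) : Matrix (Fin 2) (Fin 2) ℂ) * (((U' b)⁻¹ : Matrix.specialUnitaryGroup (Fin 2) ℂ) : Matrix (Fin 2) (Fin 2) ℂ))) else 0) =
      ∑ b : PBond P 0, if box b ∧ b.tgt = x then
        (((((U b)⁻¹ : Matrix.specialUnitaryGroup (Fin 2) ℂ) : Matrix (Fin 2) (Fin 2) ℂ) * ((U' b : Matrix.specialUnitaryGroup (Fin 2) ℂ) : Matrix (Fin 2) (Fin 2) ℂ)) -
          ((((U' b)⁻¹ : Matrix.specialUnitaryGroup (Fin 2) ℂ) : Matrix (Fin 2) (Fin 2) ℂ) * ((U b : Matrix.specialUnitaryGroup (Fin 2) ℂ) : Matrix (Fin 2) (Fin 2) ℂ))) else 0 := by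
  -- abbreviations for the four bond matrices
  set A : PBond P 0 → Matrix (Fin 2) (Fin 2) ℂ := fun b =>
    ((U' b : Matrix.specialUnitaryGroup (Fin 2) ℂ) : Matrix (Fin 2) (Fin 2) ℂ) * (((U b)⁻¹ : Matrix.specialUnitaryGroup (Fin 2) ℂ) : Matrix (Fin 2) (Fin 2) ℂ) with hA
  set A' : PBond P 0 → Matrix (Fin 2) (Fin 2) ℂ := fun b =>
    ((U b : Matrix.specialUnitaryGroup (Fin 2) ℂ) : Matrix (Fin 2) (Fin 2) ℂ) * (((U' b)⁻¹ : Matrix.specialUnitaryGroup (Fin 2) ℂ) : Matrix (Fin 2) (Fin 2) ℂ) with hA'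
  set B : PBond P 0 → Matrix (Fin 2) (Fin 2) ℂ := fun b =>
    (((U' b)⁻¹ : Matrix.specialUnitaryGroup (Fin 2) ℂ) : Matrix (Fin 2) (Fin 2) ℂ) * ((U b : Matrix.specialUnitaryGroup (Fin 2) ℂ) : Matrix (Fin 2) (Fin 2) ℂ) with hB
  set B' : PBond P 0 → Matrix (Fin 2) (Fin 2) ℂ := fun b =>
    (((U b)⁻¹ : Matrix.specialUnitaryGroup (Fin 2) ℂ) : Matrix (Fin 2) (Fin 2) ℂ) * ((U' b : Matrix.specialUnitaryGroup (Fin 2) ℂ) : Matrix (Fin 2) (Fin 2) ℂ) with hB'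
  -- conjugate transposes of the bond matrices (`Vᴴ = V⁻¹`, `(V⁻¹)ᴴ = V`)
  have hct : ∀ V : Matrix.specialUnitaryGroup (Fin 2) ℂ, ((V : Matrix (Fin 2) (Fin 2) ℂ))ᴴ = (((V⁻¹ : Matrix.specialUnitaryGroup (Fin 2) ℂ)) : Matrix (Fin 2) (Fin 2) ℂ) :=
    fun V => (coe_inv_eq_conjTranspose V).symm
  have hcti : ∀ V : Matrix.specialUnitaryGroup (Fin 2) ℂ, ((((V⁻¹ : Matrix.specialUnitaryGroup (Fin 2) ℂ)) : Matrix (Fin 2) (Fin 2) ℂ))ᴴ = (V : Matrix (Fin 2) (Fin 2) ℂ) :=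
    fun V => by rw [coe_inv_eq_conjTranspose, Matrix.conjTranspose_conjTranspose]
  have hAH : ∀ b, (A b)ᴴ = A' b := fun b => by
    simp only [hA, hA', Matrix.conjTranspose_mul, hcti, hct]
  have hBH : ∀ b, (B b)ᴴ = B' b := fun b => by
    simp only [hB, hB', Matrix.conjTranspose_mul, hcti, hct]
  -- the scalar identity of the minimiser and its Hermitian symmetry
  obtain ⟨hM, -⟩ := siteSum_eq_smul_one_of_orbitMin box U U' hmin x
  have hsym : ((∑ b : PBond P 0, if box b ∧ b.src = x then A b else 0) + ∑ b : PBond P 0, if box b ∧ b.tgt = x then B b else 0)ᴴ =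
      (∑ b : PBond P 0, if box b ∧ b.src = x then A b else 0) + ∑ b : PBond P 0, if box b ∧ b.tgt = x then B b else 0 := by
    have hM' : (∑ b : PBond P 0, if box b ∧ b.src = x then A b else 0) + (∑ b : PBond P 0, if box b ∧ b.tgt = x then B b else 0) =
        (((((∑ b : PBond P 0, if box b ∧ b.src = x then A b else 0) + ∑ b : PBond P 0, if box b ∧ b.tgt = x then B b else 0).trace).re / 2 : ℝ) : ℂ) •
          (1 : Matrix (Fin 2) (Fin 2) ℂ) := hM
    set r : ℝ := ((((∑ b : PBond P 0, if box b ∧ b.src = x then A b else 0) + ∑ b : PBond P 0, if box b ∧ b.tgt = x then B b else 0).trace).re / 2) with hr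
    rw [hM', Matrix.conjTranspose_smul, Matrix.conjTranspose_one, Complex.star_def, Complex.conj_ofReal]
  -- expand the conjugate transpose of the guarded sums
  have hexp : ((∑ b : PBond P 0, if box b ∧ b.src = x then A b else 0) + ∑ b : PBond P 0, if box b ∧ b.tgt = x then B b else 0)ᴴ =
      (∑ b : PBond P 0, if box b ∧ b.src = x then A' b else 0) + ∑ b : PBond P 0, if box b ∧ b.tgt = x then B' b else 0 := by
    rw [Matrix.conjTranspose_add, Matrix.conjTranspose_sum, Matrix.conjTranspose_sum]
    congr 1
    · exact Finset.sum_congr rfl fun b _ => by split_ifs <;> simp [hAH]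
    · exact Finset.sum_congr rfl fun b _ => by split_ifs <;> simp [hBH]
  rw [hexp] at hsym
  -- regroup: `Σ_out (A − A') = Σ_in (B' − B)`
  have hsplit : ∀ (c : PBond P 0 → Prop) [DecidablePred c] (f g : PBond P 0 → Matrix (Fin 2) (Fin 2) ℂ),
      (∑ b : PBond P 0, if c b then f b - g b else 0) = (∑ b : PBond P 0, if c b then f b else 0) - ∑ b : PBond P 0, if c b then g b else 0 := by
    intro c _ f g
    rw [← Finset.sum_sub_distrib]
    exact Finset.sum_congr rfl fun b _ => by split_ifs <;> simp
  show (∑ b : PBond P 0, if box b ∧ b.src = x then A b - A' b else 0) = ∑ b : PBond P 0, if box b ∧ b.tgt = x then B' b - B b else 0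
  rw [hsplit, hsplit, sub_eq_sub_iff_add_eq_add, add_comm (∑ b : PBond P 0, if box b ∧ b.tgt = x then B' b else 0)]
  exact hsym.symm

end Summit.QuantumFields.YangMills.Theorems.PoincareLipschitzOrbitMinKirchhoff
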